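import Literature.AlgebraicGeometry.Motives.ProjectiveNoetherNormalization
import HarnessLib

/-!
# Kedlaya's étale covers, forms on sections: the choices of `t` and of `t_1, …, t_n`

Topic `Literature/AlgebraicGeometry/Resolution`; theorem-only support for the discharge of
`Literature.AlgebraicGeometry.Resolution.Kedlaya2004_finite_etale_off_hyperplane`
(`KedlayaEtaleCovers.lean`; K. S. Kedlaya, J. Algebraic Geom. 14 (2005), Thm. 1). Kedlaya's proof
chooses (Lemma 4) "a section `t` of `𝓛^{⊗rm}` which vanishes on `E` but not at any point of `S`"
and (Lemma 5) "sections `t_1, …, t_n` of `𝓛^{⊗lrm}` which have no common zero on the vanishing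
locus `Z` of `t`", and then observes that `u_0 = t^{pl}`, `u_i = s_i s^{m(pr-1)} t^{p(l-1)} + t_i^p`
"have no common zero". Over a finite field such sections are produced by FORMS of high degree in a
projective coordinate system, as in the tree's projective Noether normalisation
(`Motives/ProjectiveNoetherNormalization`, `Motives/FormsOnSections`); this file proves the three
inputs in that language, for an integral `K`-scheme `X`, a Cartier divisor `E` and sections
`s_0, …, s_N ∈ Γ(X, 𝒪_X(E))` covering `X` (defining `ψ : X → ℙ^N_K`):

* `Kedlaya2004.exists_form_mem_of_notMem` — for a closed `Z ⊆ ℙ(𝒜)` and a point `q ∉ Z` there is a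
  homogeneous `F` vanishing on `Z` (i.e. `F ∈ 𝔭` for all `𝔭 ∈ Z`) with `F ∉ q` (homogeneous
  components of an element of the vanishing ideal of `Z`);
* `Kedlaya2004.exists_forms_baseLocus_inter_eq_empty` — **Lemma 5 over any field**: if `Z ⊆ X` is
  closed of dimension `< m` then for some `c` there are `m` forms of degree `p^c` whose sections of
  `𝒪_X(p^c E)` have no common zero on `Z` (the dimension-dropping induction of
  `CartierDivisor.exists_forms_baseLocus_dim_lt`, started at `Z` instead of `X`);
* `Kedlaya2004.isUnitAt_mul_add` — in `K(X)`: if `a` is a unit at `x`, `b` is regular but not a unit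
  at `x` and `w` is regular at `x`, then `b w + a` is a unit at `x` (the local ring `𝒪_{X,x}`); this
  is why `u_i = (…) t^{p(l-1)} + t_i^p` does not vanish where `t = 0 ≠ t_i`.

## References

* K. S. Kedlaya, *More étale covers of affine spaces in positive characteristic*, J. Algebraic
  Geom. 14 (2005) 187–192, Lemmas 4, 5 and proof of Thm. 1. [Kedlaya2004]
* U. Görtz, T. Wedhorn, *Algebraic Geometry I*, 2nd ed. (2020), Prop. 13.47, (13.11). [GortzWedhorn2020]
-/

noncomputable section

universe u

open CategoryTheory AlgebraicGeometry TopologicalSpace Opposite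
open MvPolynomial (aeval)
open Literature.AlgebraicGeometry.Motives Literature.AlgebraicGeometry.Motives.RatFn
open Literature.AlgebraicGeometry.Motives.Segre Literature.Topology

attribute [local instance] MvPolynomial.gradedAlgebra

namespace Literature.AlgebraicGeometry.Resolution

namespace Kedlaya2004

/-! ### A form vanishing on a closed subset of `Proj` and not at a given point outside it -/

section Vanishing

variable {A σ : Type*} [CommRing A] [SetLike σ A] [AddSubmonoidClass σ A] (𝒜 : ℕ → σ)
  [GradedRing 𝒜]

/-- **Closed subsets of `Proj` are cut out by forms, pointwise**: if `Z` is closed in the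
projective spectrum and `q ∉ Z`, some homogeneous element lies in every prime of `Z` but not in `q`
(take an element of the vanishing ideal of `Z = V(I(Z))` outside `q` and one of its homogeneous
components). [folklore] -/
theorem exists_form_mem_of_notMem (Z : Set (ProjectiveSpectrum 𝒜)) (hZ : IsClosed Z)
    (q : ProjectiveSpectrum 𝒜) (hq : q ∉ Z) :
    ∃ (e : ℕ) (F : A), F ∈ 𝒜 e ∧ F ∉ q.asHomogeneousIdeal ∧ ∀ z ∈ Z, F ∈ z.asHomogeneousIdeal := by
  classical
  have hZeq : ProjectiveSpectrum.zeroLocus 𝒜 (ProjectiveSpectrum.vanishingIdeal Z) = Z := by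
    rw [ProjectiveSpectrum.zeroLocus_vanishingIdeal_eq_closure, hZ.closure_eq]
  have hnot : ¬ ((ProjectiveSpectrum.vanishingIdeal Z : Set A) ⊆ q.asHomogeneousIdeal) := by
    intro hsub
    apply hq
    rw [← hZeq, ProjectiveSpectrum.mem_zeroLocus]
    exact hsub
  obtain ⟨G, hGZ, hGq⟩ := Set.not_subset.mp hnot
  -- some homogeneous component of `G` is not in `q`
  have hex : ∃ i, (DirectSum.decompose 𝒜 G i : A) ∉ q.asHomogeneousIdeal := by
    by_contra hall
    push Not at hall
    apply hGq
    rw [← DirectSum.sum_support_decompose 𝒜 G]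
    exact Ideal.sum_mem _ fun i _ => hall i
  obtain ⟨i, hi⟩ := hex
  refine ⟨i, (DirectSum.decompose 𝒜 G i : A), SetLike.coe_mem _, hi, fun z hz => ?_⟩
  have hGz : G ∈ z.asHomogeneousIdeal :=
    (ProjectiveSpectrum.mem_vanishingIdeal Z G).mp hGZ z hz
  exact z.asHomogeneousIdeal.isHomogeneous i hGz

end Vanishing

/-! ### Units of the local rings: `b w + a` -/

section Units

variable {X : Scheme.{u}} [IsIntegral X]

/-- In `K(X)`: if `a ∈ 𝒪_{X,x}^×`, `b ∈ 𝔪_{X,x}` (regular, not a unit) and `w ∈ 𝒪_{X,x}` then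
`b w + a ∈ 𝒪_{X,x}^×` (`𝒪_{X,x}` is local). [folklore] -/
theorem isUnitAt_mul_add {x : X} {a b w : X.functionField} (ha : IsUnitAt x a)
    (hb : IsRegularAt x b) (hbu : ¬ IsUnitAt x b) (hw : IsRegularAt x w) :
    IsUnitAt x (b * w + a) := by
  obtain ⟨u, rfl⟩ := ha
  obtain ⟨β, rfl⟩ := hb
  obtain ⟨ω, rfl⟩ := hw
  have hβ : β ∈ IsLocalRing.maximalIdeal (X.presheaf.stalk x) := by
    rw [IsLocalRing.mem_maximalIdeal, mem_nonunits_iff]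
    intro hβu
    exact hbu ⟨hβu.unit, by rw [IsUnit.unit_spec]⟩
  have hsum : IsUnit (β * ω + ↑u) := by
    by_contra hns
    have hmem : β * ω + ↑u ∈ IsLocalRing.maximalIdeal (X.presheaf.stalk x) := by
      rwa [IsLocalRing.mem_maximalIdeal, mem_nonunits_iff]
    have hu : (u : X.presheaf.stalk x) ∈ IsLocalRing.maximalIdeal (X.presheaf.stalk x) := by
      have := Ideal.sub_mem _ hmem (Ideal.mul_mem_right ω _ hβ)
      rwa [add_sub_cancel_left] at this
    exact ((IsLocalRing.mem_maximalIdeal _).mp hu) u.isUnit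
  exact ⟨hsum.unit, by rw [IsUnit.unit_spec, map_add, map_mul]⟩

/-- A regular non-unit times a regular function is a regular non-unit (`𝔪_{X,x}` is an ideal).
[folklore] -/
theorem not_isUnitAt_mul {x : X} {b w : X.functionField} (hb : IsRegularAt x b)
    (hbu : ¬ IsUnitAt x b) (hw : IsRegularAt x w) : ¬ IsUnitAt x (b * w) := by
  obtain ⟨β, rfl⟩ := hb
  obtain ⟨ω, rfl⟩ := hw
  rintro ⟨v, hv⟩
  rw [← map_mul] at hv
  have hβω : IsUnit (β * ω) := by
    rw [← toFunctionField_injective x hv]; exact v.isUnit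
  exact hbu ⟨(isUnit_of_mul_isUnit_left hβω).unit, by rw [IsUnit.unit_spec]⟩

end Units

/-! ### Forms with no common zero on a closed subset of small dimension (Lemma 5) -/

section Loop

variable {K : Type u} [Field K] {X : Scheme.{u}} [IsIntegral X] [X.Over (Spec (.of K))]
  [NoetherianSpace X] {E : CartierDivisor X} {N : ℕ} {s : Fin (N + 1) → X.functionField}
  (hs : ∀ i, E.IsSection (s i)) (hξ : ∀ i, genericPoint X ∈ E.nonvanishingOpens (s i))
  (hcov : ∀ x : X, ∃ i, x ∈ E.nonvanishing (s i))

include hs hξ hcov in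
/-- **The dimension-dropping forms on a closed subset.** For `p ≥ 2`, a closed `Z ⊆ X` with
`dim Z < m` and every `i ≤ m` there are forms `F₀, …, F_{i-1}` of a common degree `pᶜ`, not
vanishing at the generic point of `X`, whose common zero locus meets `Z` in dimension `< m - i`
(Kedlaya 2004, proof of Lemma 5, with "sections vanishing on `D` but not at finitely many points"
replaced by homogeneous prime avoidance, `CartierDivisor.exists_forall_le_form_generic`).
[cite: Kedlaya2004, Lemma 5 (proof)] -/
theorem exists_forms_baseLocus_inter_dim_lt {p : ℕ} (hp : 1 < p) {m : ℕ} (Z : Set X)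
    (hZc : IsClosed Z) (hdim : topologicalKrullDim Z < (m : ℕ)) :
    ∀ i, i ≤ m → ∃ (c : ℕ) (F : Fin i → MvPolynomial (Fin (N + 1)) K),
      (∀ j, F j ∈ grading (Fin (N + 1)) K (p ^ c)) ∧
      (∀ j, genericPoint X ∈ ((p ^ c) • E).nonvanishing (aeval s (F j))) ∧
      topologicalKrullDim ↥(Z ∩ CartierDivisor.baseLocus (K := K) s E (p ^ c) F) < (m - i : ℕ) := by
  classical
  intro i
  induction i with
  | zero =>
    intro _
    refine ⟨0, Fin.elim0, fun j => j.elim0, fun j => j.elim0, ?_⟩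
    have huniv : Z ∩ CartierDivisor.baseLocus (K := K) s E (p ^ 0)
        (Fin.elim0 : Fin 0 → MvPolynomial (Fin (N + 1)) K) = Z := by
      ext x; simp [CartierDivisor.baseLocus]
    rw [huniv]
    simpa using hdim
  | succ i ih =>
    intro hi
    obtain ⟨c, F, hF, hFξ, hZ⟩ := ih (Nat.le_of_succ_le hi)
    set Z₁ : Set X := Z ∩ CartierDivisor.baseLocus (K := K) s E (p ^ c) F with hZ₁def
    have hZ₁c : IsClosed Z₁ := hZc.inter (CartierDivisor.isClosed_baseLocus (K := K) (p ^ c) F)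
    obtain ⟨e₀, he₀⟩ := CartierDivisor.exists_forall_le_form_generic (K := K) hs hξ hcov Z₁ hZ₁c
    set c' : ℕ := max c e₀ with hc'
    have hcc' : c ≤ c' := le_max_left _ _
    have hpc' : e₀ ≤ p ^ c' :=
      (Nat.lt_pow_self hp).le.trans (Nat.pow_le_pow_right (by omega) (le_max_right _ _))
    obtain ⟨Fnew, hFnew, hFnewξ, hgen⟩ := he₀ (p ^ c') hpc'
    have hk : 0 < p ^ (c' - c) := Nat.pow_pos (by omega)
    have hpow : p ^ c' = p ^ c * p ^ (c' - c) := by rw [← pow_add, Nat.add_sub_cancel' hcc']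
    let F' : Fin (i + 1) → MvPolynomial (Fin (N + 1)) K :=
      Fin.snoc (α := fun _ => MvPolynomial (Fin (N + 1)) K) (fun j => F j ^ (p ^ (c' - c))) Fnew
    have hF'cast : ∀ j : Fin i, F' j.castSucc = F j ^ (p ^ (c' - c)) := fun j => by
      simp [F']
    have hF'last : F' (Fin.last i) = Fnew := by simp [F']
    have hloc : ∀ j : Fin i, ((p ^ c') • E).nonvanishing (aeval s (F' j.castSucc)) =
        ((p ^ c) • E).nonvanishing (aeval s (F j)) := fun j => by
      rw [hF'cast, map_pow, hpow]
      exact E.nonvanishing_smul_pow hk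
        (CartierDivisor.isSection_aeval hs ((MvPolynomial.mem_homogeneousSubmodule _ _).1 (hF j)))
    refine ⟨c', F', ?_, ?_, ?_⟩
    · intro j
      refine Fin.lastCases ?_ (fun j => ?_) j
      · rw [hF'last]; exact hFnew
      · rw [hF'cast, hpow, mul_comm]
        exact SetLike.pow_mem_graded _ (hF j)
    · intro j
      refine Fin.lastCases ?_ (fun j => ?_) j
      · rw [hF'last]; exact hFnewξ
      · rw [hloc]; exact hFξ j
    · have hZ' : Z ∩ CartierDivisor.baseLocus (K := K) s E (p ^ c') F' =
          {x | x ∈ Z₁ ∧ x ∉ ((p ^ c') • E).nonvanishing (aeval s Fnew)} := by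
        ext x
        simp only [hZ₁def, CartierDivisor.baseLocus, Set.mem_inter_iff, Set.mem_setOf_eq,
          Fin.forall_fin_succ', hloc, hF'last]
        tauto
      have hZ'c : IsClosed (Z ∩ CartierDivisor.baseLocus (K := K) s E (p ^ c') F') :=
        hZc.inter (CartierDivisor.isClosed_baseLocus (K := K) (p ^ c') F')
      have hsub : Z ∩ CartierDivisor.baseLocus (K := K) s E (p ^ c') F' ⊆ Z₁ := by
        rw [hZ']; exact fun x hx => hx.1
      have hdrop := topologicalKrullDim_lt_of_forall_exists_specializes hZ₁c hZ'c hsub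
        (fun z hz => by
          obtain ⟨w, hwZ, hwz, hwF⟩ := hgen z (hsub hz)
          refine ⟨w, hwZ, ?_, hwz⟩
          rw [hZ']
          exact fun h => h.2 hwF) (m - (i + 1))
      have e2 : m - (i + 1) + 1 = m - i := by omega
      exact hdrop (by rw [e2]; exact hZ)

include hs hξ hcov in
/-- **Lemma 5 (over any field).** If `Z ⊆ X` is closed with `dim Z < m` then, for `p ≥ 2`, there are
`c` and `m` forms `F_1, …, F_m` of degree `pᶜ`, each with `F_j(s) ≠ 0`, such that the sections
`F_j(s) ∈ Γ(X, 𝒪_X(pᶜ E))` have no common zero on `Z` (Kedlaya 2004, Lemma 5: "there exist sections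
`s_1, …, s_n` of `𝓛^{⊗l}` with no common zero on `D`", `dim D ≤ n - 1`).
[cite: Kedlaya2004, Lemma 5] -/
theorem exists_forms_baseLocus_inter_eq_empty {p : ℕ} (hp : 1 < p) {m : ℕ} (Z : Set X)
    (hZc : IsClosed Z) (hdim : topologicalKrullDim Z < (m : ℕ)) :
    ∃ (c : ℕ) (F : Fin m → MvPolynomial (Fin (N + 1)) K),
      (∀ j, F j ∈ grading (Fin (N + 1)) K (p ^ c)) ∧
      (∀ j, genericPoint X ∈ ((p ^ c) • E).nonvanishing (aeval s (F j))) ∧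
      Z ∩ CartierDivisor.baseLocus (K := K) s E (p ^ c) F = ∅ := by
  obtain ⟨c, F, hF, hFξ, hZ⟩ :=
    exists_forms_baseLocus_inter_dim_lt (K := K) hs hξ hcov hp Z hZc hdim m le_rfl
  refine ⟨c, F, hF, hFξ, ?_⟩
  exact eq_empty_of_topologicalKrullDim_lt_zero
    (hZc.inter (CartierDivisor.isClosed_baseLocus (K := K) (p ^ c) F)) (by simpa using hZ)

end Loop

end Kedlaya2004

end Literature.AlgebraicGeometry.Resolution

end
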